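import Summits.Langlands.Langlands.Theorems.IrregularClassicality.Negative.StationaryCollapse
import Literature.NumberTheory.Automorphic.AutomorphicRepsGLSatakeFlathProofs

/-!
# `IrregularClassicality` (stmt-Langlands-13758) — Negative knowledge III: recurring eigensystems
# and finite eigensystem range collapse the tower; deleting `3 ∈ 𝔐` makes the hypothesis `f`-free

From the standing disprover's `Cruxes/IrregularClassicality/Disproof.lean`, cdisprove cycle 2
(2026-08-16), §8–§9.  The crux (route `PicardMuOrdinary`) reads "`ρ_C` is a `3`-adic limit, in
Frobenius traces off a finite `S`, of regular algebraic cuspidal `P_k` on `GL₃(𝔸_{ℚ(ω)})` ⇒ `C` is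
automorphic"; its depth-`k` layer asks for a regular algebraic cuspidal `P` with, for `𝔭 ∉ S`,
a Satake parameter `α`, `t = N𝔭·Σα - e(a_𝔭(f)) ∈ ℤ̄` and `u ∉ 𝔐` with `u t ∈ (3^k)`.  It is NOT
refuted (it is the target weakened by a hypothesis); this file lands what any prover may cite.

* `automorphy_of_recurring_eigensystem` — UNCONDITIONAL sharpening of
  `irregularClassicality_of_stationary` (Negative knowledge I): uniqueness of Satake parameters is
  the tree's theorem `AutomorphicRepData.hasSatakeParamAt_unique_holds` (Flath), so if ONE Satake
  eigensystem `A` off `S` recurs at infinitely many depths (serving `P`, witnesses `α, t, u` and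
  datum all free to vary with the depth) then `N𝔭·ΣA(𝔭) = e(a_𝔭(f))` exactly (rigidity
  `eq_zero_of_forall_congr` applied to the now FIXED algebraic integer `t`) and the conclusion of
  the crux (= of the target) holds for `f`, by `automorphy_of_exact_regular_match`.
* `automorphy_of_recurring_member` — in particular if one `P` serves infinitely many depths.
* `automorphy_of_finite_eigensystem_range` — pigeonhole (`Finite.exists_infinite_fiber`): the
  crux HOLDS for every tower whose members' eigensystems range over finitely many Satake functions.
  So a tower on which the crux has content runs through infinitely many distinct eigensystems (on
  paper: unbounded weight or unbounded level at `S`, by Harish-Chandra finiteness; and bounded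
  regular weight is excluded anyway by continuity of Sen polynomials).
* `layer_zero_iff_integral`, `layer_iff_layer_zero_of_pow_not_mem`,
  `limitHypothesis_without_three_mem_iff`, `irregularClassicality_without_three_mem_iff` —
  load-bearing analysis of the conjunct `3 ∈ 𝔐`: `e(a_𝔭(f)) ∈ ℤ̄`
  (`isIntegral_embedding_picardTrace`), so depth `0` is the `f`-FREE integrality property
  "`N𝔭·Σα(P,𝔭) ∈ ℤ̄` off `S`"; if `3^k ∉ 𝔐` depth `k` is depth `0` (`u := 3^k`); hence with `3 ∈ 𝔐`
  deleted (a maximal `𝔐 ∋ 2` is then admissible, `exists_isMaximal_two_mem_three_not_mem`) the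
  hypothesis is equivalent to that integrality property and the crux becomes LITERALLY
  "(some regular algebraic cuspidal `P` on `GL₃/ℚ(ω)` with integral `N𝔭·Σα` off a finite set
  exists) → (the target at the same level datum)".  The conjunct `3 ∈ 𝔐` carries the entire
  `f`-dependent content of the hypothesis.

Mathlib + `Negative/StationaryCollapse` + `AutomorphicRepsGLSatakeFlathProofs` only. [folklore]
-/

set_option linter.dupNamespace false

namespace Summit.Langlands.Langlands.Theorems.IrregularClassicality.Negative

open Literature.NumberTheory.Automorphic Literature.NumberTheory.GaloisRepresentations
open NumberField IsDedekindDomain Polynomial Filter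

open scoped Classical

/-! ### Recurrence of one eigensystem -/

/-- **A recurring eigensystem collapses the tower.**  Let `𝔐 ∋ 3` be maximal in `ℤ̄` and
`A : 𝔭 ↦ A 𝔭` a Satake function off `S`.  If for every `k` there are `l ≥ k` and a regular
algebraic cuspidal `P` on `GL₃(𝔸_{ℚ(ω)})` with Satake parameters `A` off `S` serving depth `l`
of the crux's tower for `f` (`N𝔭·Σα ≡ e(a_𝔭(f)) (mod 3^l ℤ̄_𝔐)` off `S`), then the conclusion of
`IrregularClassicality` (= of `PicardAutomorphy`) holds for `f`.  Proof: at every depth the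
witness `α` IS `A 𝔭` (`hasSatakeParamAt_unique_holds`), so `t = N𝔭·ΣA(𝔭) - e(a_𝔭(f))` is one
fixed algebraic integer with `v_𝔐(t) ≥ k` for all `k`, hence `t = 0` (`eq_zero_of_forall_congr`),
and `automorphy_of_exact_regular_match` applies to any serving `P`. [folklore] -/
theorem automorphy_of_recurring_eigensystem {f : ℤ[X]}
    {hcpt : isCompact_glFiniteIntegralLevel 3 (CyclotomicField 3 ℚ)}
    (e : CyclotomicField 3 ℚ →+* ℂ) {𝔐 : Ideal (integralClosure ℤ ℂ)} (h𝔐 : 𝔐.IsMaximal)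
    (h3 : (3 : integralClosure ℤ ℂ) ∈ 𝔐)
    (S : Finset (HeightOneSpectrum (𝓞 (CyclotomicField 3 ℚ))))
    (A : HeightOneSpectrum (𝓞 (CyclotomicField 3 ℚ)) → Multiset ℂ)
    (h : ∀ k : ℕ, ∃ l, k ≤ l ∧
      ∃ P : CuspidalAutomorphicRepData 3 (CyclotomicField 3 ℚ) hcpt, P.1.IsRegularAlgebraic ∧
        (∀ 𝔭 ∉ S, P.1.HasSatakeParamAt 𝔭 (A 𝔭)) ∧
        ∀ 𝔭 ∉ S, ∃ (α : Multiset ℂ) (t u : integralClosure ℤ ℂ), P.1.HasSatakeParamAt 𝔭 α ∧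
          (t : ℂ) = (𝔭.residueCard : ℂ) * α.sum - e (picardTrace f 𝔭) ∧ u ∉ 𝔐 ∧
          u * t ∈ Ideal.span {(3 : integralClosure ℤ ℂ) ^ l}) :
    ∃ (e : CyclotomicField 3 ℚ →+* ℂ)
      (π : CuspidalAutomorphicRepData 3 (CyclotomicField 3 ℚ) hcpt), π.1.IsLAlgebraic ∧
      ∀ᶠ 𝔭 : HeightOneSpectrum (𝓞 (CyclotomicField 3 ℚ)) in cofinite, ∃ α : Multiset ℂ,
        π.1.HasSatakeParamAt 𝔭 α ∧ α.sum = e (picardTrace f 𝔭) := by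
  obtain ⟨l₀, -, P₀, hP₀, hA₀, hs₀⟩ := h 0
  refine automorphy_of_exact_regular_match e S P₀ hP₀ fun 𝔭 h𝔭 => ⟨A 𝔭, hA₀ 𝔭 h𝔭, ?_⟩
  obtain ⟨α₀, t₀, u₀, hα₀, ht₀, -, -⟩ := hs₀ 𝔭 h𝔭
  have hαA : α₀ = A 𝔭 := P₀.1.hasSatakeParamAt_unique_holds hα₀ (hA₀ 𝔭 h𝔭)
  rw [hαA] at ht₀
  have hcong : ∀ k : ℕ, ∃ u ∉ 𝔐, u * t₀ ∈ Ideal.span {(3 : integralClosure ℤ ℂ) ^ k} := by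
    intro k
    obtain ⟨l, hkl, P, -, hA, hs⟩ := h k
    obtain ⟨α, t, u, hα, ht, hu, hut⟩ := hs 𝔭 h𝔭
    have hαA' : α = A 𝔭 := P.1.hasSatakeParamAt_unique_holds hα (hA 𝔭 h𝔭)
    rw [hαA'] at ht
    have htt : t = t₀ := Subtype.ext (by rw [ht, ht₀])
    rw [htt] at hut
    exact ⟨u, hu, Ideal.span_singleton_le_span_singleton.2 (pow_dvd_pow 3 hkl) hut⟩
  have ht00 : t₀ = 0 := eq_zero_of_forall_congr h𝔐 h3 hcong
  rw [ht00] at ht₀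
  have : ((𝔭.residueCard : ℂ) * (A 𝔭).sum - e (picardTrace f 𝔭)) = 0 := by rw [← ht₀]; simp
  exact sub_eq_zero.1 this

/-- **A recurring MEMBER suffices**: one regular algebraic cuspidal `P` serving infinitely many
depths (its Satake witnesses, `t` and `u` free to vary with the depth) already gives the
conclusion — the sharpening of `irregularClassicality_of_stationary` by Satake uniqueness.
[folklore] -/
theorem automorphy_of_recurring_member {f : ℤ[X]}
    {hcpt : isCompact_glFiniteIntegralLevel 3 (CyclotomicField 3 ℚ)}
    (e : CyclotomicField 3 ℚ →+* ℂ) {𝔐 : Ideal (integralClosure ℤ ℂ)} (h𝔐 : 𝔐.IsMaximal)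
    (h3 : (3 : integralClosure ℤ ℂ) ∈ 𝔐)
    (S : Finset (HeightOneSpectrum (𝓞 (CyclotomicField 3 ℚ))))
    (P : CuspidalAutomorphicRepData 3 (CyclotomicField 3 ℚ) hcpt) (hP : P.1.IsRegularAlgebraic)
    (h : ∀ k : ℕ, ∃ l, k ≤ l ∧
      ∀ 𝔭 ∉ S, ∃ (α : Multiset ℂ) (t u : integralClosure ℤ ℂ), P.1.HasSatakeParamAt 𝔭 α ∧
        (t : ℂ) = (𝔭.residueCard : ℂ) * α.sum - e (picardTrace f 𝔭) ∧ u ∉ 𝔐 ∧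
        u * t ∈ Ideal.span {(3 : integralClosure ℤ ℂ) ^ l}) :
    ∃ (e : CyclotomicField 3 ℚ →+* ℂ)
      (π : CuspidalAutomorphicRepData 3 (CyclotomicField 3 ℚ) hcpt), π.1.IsLAlgebraic ∧
      ∀ᶠ 𝔭 : HeightOneSpectrum (𝓞 (CyclotomicField 3 ℚ)) in cofinite, ∃ α : Multiset ℂ,
        π.1.HasSatakeParamAt 𝔭 α ∧ α.sum = e (picardTrace f 𝔭) := by
  obtain ⟨l₀, -, hs₀⟩ := h 0
  -- the eigensystem of `P` off `S`, read off the depth-`l₀` witnesses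
  let A : HeightOneSpectrum (𝓞 (CyclotomicField 3 ℚ)) → Multiset ℂ := fun 𝔭 =>
    if h𝔭 : 𝔭 ∈ S then 0 else Classical.choose (hs₀ 𝔭 h𝔭)
  have hA : ∀ 𝔭 ∉ S, P.1.HasSatakeParamAt 𝔭 (A 𝔭) := fun 𝔭 h𝔭 => by
    obtain ⟨t, u, hα, -⟩ := Classical.choose_spec (hs₀ 𝔭 h𝔭)
    simp only [A, dif_neg h𝔭]
    exact hα
  refine automorphy_of_recurring_eigensystem e h𝔐 h3 S A ?_
  intro k
  obtain ⟨l, hkl, hs⟩ := h k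
  exact ⟨l, hkl, P, hP, hA, hs⟩

/-! ### Finite eigensystem range: pigeonhole -/

/-- **`IrregularClassicality` holds for every tower of finite eigensystem range.**  If the
crux's tower for `f` can be served, at every depth `k`, by a regular algebraic cuspidal `P` whose
Satake function off `S` is one of finitely many `A 0, …, A (m-1)`, then the conclusion holds for
`f` (some index recurs at infinitely many depths — `Finite.exists_infinite_fiber` — and
`automorphy_of_recurring_eigensystem` applies).  So a tower on which the crux has content runs
through infinitely many distinct eigensystems; on paper (Harish-Chandra finiteness + strong
multiplicity one) its members then have unbounded infinity type or unbounded level at `S`.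
[folklore] -/
theorem automorphy_of_finite_eigensystem_range {f : ℤ[X]}
    {hcpt : isCompact_glFiniteIntegralLevel 3 (CyclotomicField 3 ℚ)}
    (e : CyclotomicField 3 ℚ →+* ℂ) {𝔐 : Ideal (integralClosure ℤ ℂ)} (h𝔐 : 𝔐.IsMaximal)
    (h3 : (3 : integralClosure ℤ ℂ) ∈ 𝔐)
    (S : Finset (HeightOneSpectrum (𝓞 (CyclotomicField 3 ℚ)))) {m : ℕ}
    (A : Fin m → HeightOneSpectrum (𝓞 (CyclotomicField 3 ℚ)) → Multiset ℂ)
    (h : ∀ k : ℕ, ∃ (i : Fin m) (P : CuspidalAutomorphicRepData 3 (CyclotomicField 3 ℚ) hcpt),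
      P.1.IsRegularAlgebraic ∧ (∀ 𝔭 ∉ S, P.1.HasSatakeParamAt 𝔭 (A i 𝔭)) ∧
      ∀ 𝔭 ∉ S, ∃ (α : Multiset ℂ) (t u : integralClosure ℤ ℂ), P.1.HasSatakeParamAt 𝔭 α ∧
        (t : ℂ) = (𝔭.residueCard : ℂ) * α.sum - e (picardTrace f 𝔭) ∧ u ∉ 𝔐 ∧
        u * t ∈ Ideal.span {(3 : integralClosure ℤ ℂ) ^ k}) :
    ∃ (e : CyclotomicField 3 ℚ →+* ℂ)
      (π : CuspidalAutomorphicRepData 3 (CyclotomicField 3 ℚ) hcpt), π.1.IsLAlgebraic ∧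
      ∀ᶠ 𝔭 : HeightOneSpectrum (𝓞 (CyclotomicField 3 ℚ)) in cofinite, ∃ α : Multiset ℂ,
        π.1.HasSatakeParamAt 𝔭 α ∧ α.sum = e (picardTrace f 𝔭) := by
  choose i hi using h
  obtain ⟨j, hj⟩ := Finite.exists_infinite_fiber i
  have hinf : (i ⁻¹' {j}).Infinite := Set.infinite_coe_iff.1 hj
  refine automorphy_of_recurring_eigensystem e h𝔐 h3 S (A j) ?_
  intro k
  obtain ⟨l, hl, hkl⟩ := hinf.exists_gt k
  obtain ⟨P, hP, hA, hs⟩ := hi l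
  have hlj : i l = j := hl
  exact ⟨l, hkl.le, P, hP, fun 𝔭 h𝔭 => hlj ▸ hA 𝔭 h𝔭, hs⟩

/-! ### The conjunct `3 ∈ 𝔐` carries the whole `f`-dependence of the hypothesis -/

/-- `e(a_𝔭(f))` is an algebraic integer (image of an element of `𝓞 ℚ(ω)`). [folklore] -/
theorem isIntegral_embedding_picardTrace (e : CyclotomicField 3 ℚ →+* ℂ) (f : ℤ[X])
    (𝔭 : HeightOneSpectrum (𝓞 (CyclotomicField 3 ℚ))) : IsIntegral ℤ (e (picardTrace f 𝔭)) :=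
  map_isIntegral_int e (RingOfIntegers.isIntegral_coe (picardTrace f 𝔭))

/-- **Depth `0` forgets `f`.**  For `𝔐 ≠ ⊤`, the depth-`0` layer of the crux's tower (where
`(3^0) = ℤ̄` makes the congruence vacuous) is equivalent to the `f`-FREE integrality property:
some regular algebraic cuspidal `P` has `N𝔭 · Σ Satake(P, 𝔭) ∈ ℤ̄` for every `𝔭 ∉ S`. [folklore] -/
theorem layer_zero_iff_integral {f : ℤ[X]}
    {hcpt : isCompact_glFiniteIntegralLevel 3 (CyclotomicField 3 ℚ)} (e : CyclotomicField 3 ℚ →+* ℂ)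
    {𝔐 : Ideal (integralClosure ℤ ℂ)} (h𝔐 : 𝔐 ≠ ⊤)
    (S : Finset (HeightOneSpectrum (𝓞 (CyclotomicField 3 ℚ)))) :
    (∃ P : CuspidalAutomorphicRepData 3 (CyclotomicField 3 ℚ) hcpt, P.1.IsRegularAlgebraic ∧
      ∀ 𝔭 ∉ S, ∃ (α : Multiset ℂ) (t u : integralClosure ℤ ℂ), P.1.HasSatakeParamAt 𝔭 α ∧
        (t : ℂ) = (𝔭.residueCard : ℂ) * α.sum - e (picardTrace f 𝔭) ∧ u ∉ 𝔐 ∧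
        u * t ∈ Ideal.span {(3 : integralClosure ℤ ℂ) ^ 0}) ↔
    ∃ P : CuspidalAutomorphicRepData 3 (CyclotomicField 3 ℚ) hcpt, P.1.IsRegularAlgebraic ∧
      ∀ 𝔭 ∉ S, ∃ α : Multiset ℂ, P.1.HasSatakeParamAt 𝔭 α ∧
        IsIntegral ℤ ((𝔭.residueCard : ℂ) * α.sum) := by
  constructor
  · rintro ⟨P, hP, h⟩
    refine ⟨P, hP, fun 𝔭 h𝔭 => ?_⟩
    obtain ⟨α, t, u, hα, ht, -, -⟩ := h 𝔭 h𝔭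
    refine ⟨α, hα, ?_⟩
    have heq : (𝔭.residueCard : ℂ) * α.sum = t + e (picardTrace f 𝔭) := by rw [ht]; ring
    rw [heq]
    exact ((mem_integralClosure_iff ℤ ℂ).1 t.2).add (isIntegral_embedding_picardTrace e f 𝔭)
  · rintro ⟨P, hP, h⟩
    obtain ⟨w, hw⟩ : ∃ w : integralClosure ℤ ℂ, w ∉ 𝔐 := by
      by_contra hall
      exact h𝔐 ((Ideal.eq_top_iff_one _).2 (not_not.1 (not_exists.1 hall 1)))
    refine ⟨P, hP, fun 𝔭 h𝔭 => ?_⟩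
    obtain ⟨α, hα, hint⟩ := h 𝔭 h𝔭
    refine ⟨α, ⟨(𝔭.residueCard : ℂ) * α.sum, (mem_integralClosure_iff ℤ ℂ).2 hint⟩ -
      ⟨e (picardTrace f 𝔭), (mem_integralClosure_iff ℤ ℂ).2 (isIntegral_embedding_picardTrace e f 𝔭)⟩,
      w, hα, ?_, hw, by simp⟩
    push_cast
    ring

/-- **If `3^k ∉ 𝔐`, depth `k` is depth `0`** (`u := 3^k` serves every `t`). [folklore] -/
theorem layer_iff_layer_zero_of_pow_not_mem {f : ℤ[X]}
    {hcpt : isCompact_glFiniteIntegralLevel 3 (CyclotomicField 3 ℚ)} (e : CyclotomicField 3 ℚ →+* ℂ)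
    {𝔐 : Ideal (integralClosure ℤ ℂ)} (S : Finset (HeightOneSpectrum (𝓞 (CyclotomicField 3 ℚ))))
    {k : ℕ} (hk : (3 : integralClosure ℤ ℂ) ^ k ∉ 𝔐) :
    (∃ P : CuspidalAutomorphicRepData 3 (CyclotomicField 3 ℚ) hcpt, P.1.IsRegularAlgebraic ∧
      ∀ 𝔭 ∉ S, ∃ (α : Multiset ℂ) (t u : integralClosure ℤ ℂ), P.1.HasSatakeParamAt 𝔭 α ∧
        (t : ℂ) = (𝔭.residueCard : ℂ) * α.sum - e (picardTrace f 𝔭) ∧ u ∉ 𝔐 ∧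
        u * t ∈ Ideal.span {(3 : integralClosure ℤ ℂ) ^ k}) ↔
    ∃ P : CuspidalAutomorphicRepData 3 (CyclotomicField 3 ℚ) hcpt, P.1.IsRegularAlgebraic ∧
      ∀ 𝔭 ∉ S, ∃ (α : Multiset ℂ) (t u : integralClosure ℤ ℂ), P.1.HasSatakeParamAt 𝔭 α ∧
        (t : ℂ) = (𝔭.residueCard : ℂ) * α.sum - e (picardTrace f 𝔭) ∧ u ∉ 𝔐 ∧
        u * t ∈ Ideal.span {(3 : integralClosure ℤ ℂ) ^ 0} := by
  constructor
  · rintro ⟨P, hP, h⟩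
    refine ⟨P, hP, fun 𝔭 h𝔭 => ?_⟩
    obtain ⟨α, t, u, hα, ht, hu, -⟩ := h 𝔭 h𝔭
    exact ⟨α, t, u, hα, ht, hu, by simp⟩
  · rintro ⟨P, hP, h⟩
    refine ⟨P, hP, fun 𝔭 h𝔭 => ?_⟩
    obtain ⟨α, t, -, hα, ht, -, -⟩ := h 𝔭 h𝔭
    exact ⟨α, t, (3 : integralClosure ℤ ℂ) ^ k, hα, ht, hk,
      Ideal.mul_mem_right t _ (Ideal.mem_span_singleton_self _)⟩

/-- A maximal ideal of `ℤ̄` above `2` exists, and it does not contain `3` (`3 - 2 = 1`).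
[folklore] -/
theorem exists_isMaximal_two_mem_three_not_mem :
    ∃ 𝔐 : Ideal (integralClosure ℤ ℂ), 𝔐.IsMaximal ∧ (2 : integralClosure ℤ ℂ) ∈ 𝔐 ∧
      (3 : integralClosure ℤ ℂ) ∉ 𝔐 := by
  have h2 : (Ideal.span {(2 : ℤ)}).IsMaximal :=
    PrincipalIdealRing.isMaximal_of_irreducible Int.prime_two.irreducible
  obtain ⟨Q, hQ, hQc⟩ := Ideal.exists_ideal_over_maximal_of_isIntegral (S := integralClosure ℤ ℂ)
    (Ideal.span {(2 : ℤ)}) (fun x hx => by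
      rw [RingHom.mem_ker] at hx
      have : (x : integralClosure ℤ ℂ) = 0 := hx
      have hx0 : x = 0 := by exact_mod_cast congrArg Subtype.val this
      simp [hx0])
  have h2Q : (2 : integralClosure ℤ ℂ) ∈ Q := by
    have : (2 : ℤ) ∈ Q.comap (algebraMap ℤ (integralClosure ℤ ℂ)) := by
      rw [hQc]; exact Ideal.mem_span_singleton_self 2
    simpa using this
  refine ⟨Q, hQ, h2Q, fun h3 => ?_⟩
  have h1 : (1 : integralClosure ℤ ℂ) = 3 - 2 := by norm_num
  exact hQ.ne_top ((Ideal.eq_top_iff_one _).2 (h1 ▸ Q.sub_mem h3 h2Q))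

/-- **With `3 ∈ 𝔐` deleted, the limit hypothesis forgets `f`.**  The crux's hypothesis minus the
conjunct `3 ∈ 𝔐` is equivalent to the `f`-free integrality property of the level datum `hcpt`
(`→`: depth `0` and `layer_zero_iff_integral`; `←`: choose `𝔐` maximal above `2`, then
`3^k ∉ 𝔐` and every depth is depth `0`). [folklore] -/
theorem limitHypothesis_without_three_mem_iff (f : ℤ[X])
    (hcpt : isCompact_glFiniteIntegralLevel 3 (CyclotomicField 3 ℚ)) :
    (∃ (e : CyclotomicField 3 ℚ →+* ℂ) (𝔐 : Ideal (integralClosure ℤ ℂ))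
        (S : Finset (HeightOneSpectrum (𝓞 (CyclotomicField 3 ℚ)))), 𝔐.IsMaximal ∧
        ∀ k : ℕ, ∃ P : CuspidalAutomorphicRepData 3 (CyclotomicField 3 ℚ) hcpt,
          P.1.IsRegularAlgebraic ∧ ∀ 𝔭 ∉ S, ∃ (α : Multiset ℂ) (t u : integralClosure ℤ ℂ),
            P.1.HasSatakeParamAt 𝔭 α ∧
            (t : ℂ) = (𝔭.residueCard : ℂ) * α.sum - e (picardTrace f 𝔭) ∧ u ∉ 𝔐 ∧
            u * t ∈ Ideal.span {(3 : integralClosure ℤ ℂ) ^ k}) ↔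
    ∃ (S : Finset (HeightOneSpectrum (𝓞 (CyclotomicField 3 ℚ))))
      (P : CuspidalAutomorphicRepData 3 (CyclotomicField 3 ℚ) hcpt), P.1.IsRegularAlgebraic ∧
      ∀ 𝔭 ∉ S, ∃ α : Multiset ℂ, P.1.HasSatakeParamAt 𝔭 α ∧
        IsIntegral ℤ ((𝔭.residueCard : ℂ) * α.sum) := by
  constructor
  · rintro ⟨e, 𝔐, S, h𝔐, h⟩
    exact ⟨S, (layer_zero_iff_integral e h𝔐.ne_top S).1 (h 0)⟩
  · rintro ⟨S, hS⟩
    obtain ⟨𝔐, h𝔐, -, h3⟩ := exists_isMaximal_two_mem_three_not_mem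
    have he : Nonempty (CyclotomicField 3 ℚ →+* ℂ) := by
      rw [← Fintype.card_pos_iff, NumberField.Embeddings.card]
      exact Module.finrank_pos
    obtain ⟨e⟩ := he
    refine ⟨e, 𝔐, S, h𝔐, fun k => ?_⟩
    have hk : (3 : integralClosure ℤ ℂ) ^ k ∉ 𝔐 := fun hk => h3 (h𝔐.isPrime.mem_of_pow_mem k hk)
    rw [layer_iff_layer_zero_of_pow_not_mem e S hk, layer_zero_iff_integral e h𝔐.ne_top S]
    exact hS

/-- **Load-bearing analysis of `3 ∈ 𝔐`.**  The crux `IrregularClassicality` with the conjunct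
`3 ∈ 𝔐` deleted from its hypothesis is LITERALLY the statement "if some regular algebraic cuspidal
`P` on `GL₃(𝔸_{ℚ(ω)})` has `N𝔭·Σ Satake(P,𝔭) ∈ ℤ̄` off a finite set, then every generic Picard curve
is automorphic over `ℚ(ω)` (the target's conclusion, at the same level datum)".  So `3 ∈ 𝔐`
(together with `u ∉ 𝔐`) carries the entire `f`-dependent, `3`-adic content of the hypothesis; on
paper the antecedent is true, so the variant is the target itself and admits no
`_false_without_` theorem short of refuting the target. [folklore] -/
theorem irregularClassicality_without_three_mem_iff :
    (∀ (f : ℤ[X]) (hcpt : isCompact_glFiniteIntegralLevel 3 (CyclotomicField 3 ℚ)),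
      f.natDegree = 4 → (f.map (Int.castRingHom ℚ)).Separable →
      12 ∣ Nat.card (f.map (Int.castRingHom ℚ)).Gal →
      (∃ (e : CyclotomicField 3 ℚ →+* ℂ) (𝔐 : Ideal (integralClosure ℤ ℂ))
          (S : Finset (HeightOneSpectrum (𝓞 (CyclotomicField 3 ℚ)))), 𝔐.IsMaximal ∧
          ∀ k : ℕ, ∃ P : CuspidalAutomorphicRepData 3 (CyclotomicField 3 ℚ) hcpt,
            P.1.IsRegularAlgebraic ∧ ∀ 𝔭 ∉ S, ∃ (α : Multiset ℂ) (t u : integralClosure ℤ ℂ),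
              P.1.HasSatakeParamAt 𝔭 α ∧
              (t : ℂ) = (𝔭.residueCard : ℂ) * α.sum - e (picardTrace f 𝔭) ∧ u ∉ 𝔐 ∧
              u * t ∈ Ideal.span {(3 : integralClosure ℤ ℂ) ^ k}) →
      ∃ (e : CyclotomicField 3 ℚ →+* ℂ)
        (π : CuspidalAutomorphicRepData 3 (CyclotomicField 3 ℚ) hcpt), π.1.IsLAlgebraic ∧
        ∀ᶠ 𝔭 : HeightOneSpectrum (𝓞 (CyclotomicField 3 ℚ)) in cofinite, ∃ α : Multiset ℂ,
          π.1.HasSatakeParamAt 𝔭 α ∧ α.sum = e (picardTrace f 𝔭)) ↔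
    ∀ hcpt : isCompact_glFiniteIntegralLevel 3 (CyclotomicField 3 ℚ),
      (∃ (S : Finset (HeightOneSpectrum (𝓞 (CyclotomicField 3 ℚ))))
        (P : CuspidalAutomorphicRepData 3 (CyclotomicField 3 ℚ) hcpt), P.1.IsRegularAlgebraic ∧
        ∀ 𝔭 ∉ S, ∃ α : Multiset ℂ, P.1.HasSatakeParamAt 𝔭 α ∧
          IsIntegral ℤ ((𝔭.residueCard : ℂ) * α.sum)) →
      ∀ f : ℤ[X], f.natDegree = 4 → (f.map (Int.castRingHom ℚ)).Separable →
        12 ∣ Nat.card (f.map (Int.castRingHom ℚ)).Gal →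
        ∃ (e : CyclotomicField 3 ℚ →+* ℂ)
          (π : CuspidalAutomorphicRepData 3 (CyclotomicField 3 ℚ) hcpt), π.1.IsLAlgebraic ∧
          ∀ᶠ 𝔭 : HeightOneSpectrum (𝓞 (CyclotomicField 3 ℚ)) in cofinite, ∃ α : Multiset ℂ,
            π.1.HasSatakeParamAt 𝔭 α ∧ α.sum = e (picardTrace f 𝔭) := by
  constructor
  · intro h hcpt hI f hdeg hsep hgal
    exact h f hcpt hdeg hsep hgal ((limitHypothesis_without_three_mem_iff f hcpt).2 hI)
  · intro h f hcpt hdeg hsep hgal hL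
    exact h hcpt ((limitHypothesis_without_three_mem_iff f hcpt).1 hL) f hdeg hsep hgal

end Summit.Langlands.Langlands.Theorems.IrregularClassicality.Negative
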